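/-
Copyright (c) 2026 the pub-hodgecm-mathlib formalisation cell (harness21).  Prover seat hodgecm-mathlib-LH4-p15 (g0), req620 Track A «(D-RAM) FOUR-FRAME» squad
(STAGE-1b, row (2) of the piece `f_{T₊}`, the (β₂) road (R-36) «PURE-CELL LEDGER, RELATIVE SIGNS»: β₂ sub-dealer LH4-p04 (g8) β₂-BOARD v1.2 rows (L-S1) (LH4-p09 (g9)), (L-T)∕(ρ-c),
(K-b) (LH4-p16 (g0)); frame ★ p861810 (LH4-p16 (g0)), ray ★ p861653 ∕ ★ p861454 (LH4-p16), glue ★ p861637 (LH4-p19 (g0)), shell flip ★ p861900 (this seat)), 2026-09-04.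
-/
import Summits.HodgeConjecture.HodgeConjecture.Theorems.F0P3cDyRamRayDominatedCellLetter   -- ★ p861810 (LH4-p16 (g0)): the frame, `v_le_iff_v_inv_mul_le_one`, `v_map_le_map_pow_of_le`; brings ★ p861653 `normFormSet_eq_ray_of_isOrd`, ★ p861372 HEAD B, ★ p861637 glue letters
import Summits.HodgeConjecture.HodgeConjecture.Theorems.F0P3cDyRamLabelShellFlipCardTwo      -- ★ p861900 (this seat): (S1) `valueSetMod_smul_xPlus_eq_twist_of_v_sub_eq_shell`; brings ★ p861154 §1 dictionary, ★ `valueSetMod_smul_xPlus_mul_norm`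
import HarnessLib

/-!
# Crux `H413`, line LH4 «(D-RAM) FOUR-FRAME» — the (β₂) road (R-36) «PURE-CELL LEDGER, RELATIVE SIGNS»: «THE LETTER OF A BOUNDARY CELL IS THE c-TWIST `(c·f·h_W) • X₊`» — one digit
# short of the clean scale (`δ = c + m* − 1`, conductor gap `c ≥ 1`, `q = 2`, `d` even) the census letter of a ray-dominated glued vertex is the OPPOSITE label class of the clean
# cells' letter `(f·h_W) • X₊` (★ p861810): `S₁` at `δ = 4`, the last tower cell `c = δ − 2`, `K₀` at its boundary — LH4-p09 (g9)'s relative sign `−1`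

Cell `hodgecm-mathlib` (D-0151), FLOOR 0, crux item H413 = `stmt-HodgeConjecture-24833`, route of record `HCCMUnconditional`; squad F0∕P3c∕LH4; lane
`--supports stmt-HodgeConjecture-24833 --as helper` (count-neutral; pays NO tier-0 row).  THEOREMS ONLY (no `def`, no instance, no notation, no `sorry`, default heartbeats);
★-only imports; states NO law; (β₂) stays a HYPOTHESIS.  DATUM-FREE: the plane field `E` (complete, ramified quadratic datum `(σ, ϖ, d, t_E)`, `|2| < 1`, residue field of TWO
elements, `d` even) and the line model `M` (`jE`, `ρ`, `Θ`) of ★ (C1); no residue-field identification beyond `#𝓀[E] = 2`, no `|2|`-exponent.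

WHY (LH4-p09 (g9) 15:55:38Z «the relative sign `ω(e_S ∕ (f·h_W)) = −1 (δ = 4) ∕ +1 (δ ≥ 6)`»; heir LEAD T20-19 (ρ-b) «S₁ = −D₁ at δ = 4», (ρ-c) «T_k = −2·T_{k−1}», (κ-b);
model `work/model/tower_experiment.py` 16:24:27Z: a cell of conductor gap `c` carries D's letter iff `δ − c ≥ m*` and the FLIPPED letter at `δ − c = m* − 1`, 0 unclean).
★ p861810 `valueSet_endoGL_sub_one_glued_eq_smul_xPlus_of_isOrd` (LH4-p16 (g0)) reads the letter `(f·h_W) • X₊` off ANY ray-dominated cell whose depth multiplier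
`μ = lam − jE u₀₀` is `E`-rational to the cell's scale: `hlam : |μ + jE(f·t₊·(ϖσϖ)^b)| ≤ |jEϖ|^{m}·|D₀|`, `D₀ = cc(α − ρα)·ΘY`.  ONE DIGIT SHORT — `hlam′` at `|jEϖ|^{m*−1}·|D₀|`
with `|μ − ρμ| = |jEϖ|^{m*−1}·|D₀|` EXACTLY (`hjl`) — the `E`-shift `θ = μ + jE F` is anti-invariant at leading order (`|θ − ρθ| = |θ|`), and OFF the diagonal (`hgap :
|D₀| < |jEϖ|^{2b}`, i.e. conductor gap `c ≥ 1`) the trace `Tr_ρ(D₀⁻¹) = jE⟨w₀, w₀⟩` (★ p861637) LOSES a digit (`|⟨w₀,w₀⟩| = |ϖ|^{−2b}` by integrality of the glue generator), so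
dyadically `|Tr_ρ(θ∕D₀)| = |θ|∕|D₀| = |jEϖ|^{m*−1}` EXACTLY (§1).  Hence the ray scalar `e₀` (`jE e₀ = Tr_ρ(μ∕D₀)`, ★ p861653) sits at distance EXACTLY `|ϖ|^{m*−1} = |ϖ|^{2(d−1)}`
from `f·h_W·t₊·N(ϖ^b g₁)` (§2), and ★ p861900 (S1) turns that digit into the non-norm twist (§3):
* §1 (M, dyadic) `v_add_map_eq_of_v_sub_map_eq` (`|θ − ρθ| = |θ| ⇒ |θ + ρθ| = |θ|`), `v_sub_map_lt_of_v_add_map_lt`, `v_trace_mul_eq_of_anti` (`|θ − ρθ| = |θ|`, `|ν + ρν| < |ν|`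
  ⇒ `|θν + ρ(θν)| = |θ|·|ν|`); (E ↔ M) `v_map_eq_one_iff`, `v_map_eq_map_pow_iff`, `v_map_lt_one_of_lt`; glue `v_inv_add_map_inv_lt` (`Tr_ρ(D₀⁻¹) = jE pw`, `|pw + σg₁·h_W·g₁| ≤ 1`,
  `|ϖ^b g₁| = 1`, `|h_W| = 1`, `1 ≤ b`, `|D₀| < |jEϖ|^{2b}` ⇒ `|D₀⁻¹ + ρD₀⁻¹| < |D₀⁻¹|`).
* §2 `v_trace_div_sub_main_eq` — THE EXACT SIZE: `|Tr_ρ(μ∕D₀) − jE(f·h_W·(t·N(ϖ^b g₁)))| = |jEϖ|^n` under `hlam′`, `hjl` at exponent `n < m`, `|jE(f t (ϖσϖ)^b)| ≤ |jEϖ|^m`, §1.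
* §3 HEAD `valueSet_endoGL_sub_one_glued_eq_twist_smul_xPlus_of_boundary` — ★ p861810's frame VERBATIM with `hlam` replaced by (`hlam′`, `hjl`, `hgap`) at `m = m* = mstarOfRecord d`,
  plus `σf = f`, `|f| = 1`, `σh_W = h_W`, `|h_W| = 1`, the datum `hD`, `|2| < 1`, `#𝓀[E] = 2`, `d` even: the `ϖ^{m*}`-value set of `Γ − 1` on `L` is
  `valueSetMod σ ϖ m* ((c·(f·h_W)) • xPlus σ ϖ d)` for every σ-fixed non-norm unit `c`; COROLLARY `…_ne_smul_xPlus_of_boundary`: it is NOT `valueSetMod σ ϖ m* ((f·h_W) • X₊)`.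
HONEST LABEL.  Count-neutral norm-class ∕ value-set algebra; nothing printed is asserted; no census law is stated; ray-domination (`hYO hμ hμt`), the boundary letters and the
integrality of the vertex are HYPOTHESES the (L-S1)∕(L-T)∕(K-b) instances discharge; `HC_CM` is proved only modulo the 7 printed citations (2 remaining named inputs: hLiu418 =
`stmt-HodgeConjecture-24832`, h413 = `stmt-HodgeConjecture-24833`) until rung 0 closes.
## References
* [Jacobowitz1962] R. Jacobowitz, *Hermitian forms over local fields*, Amer. J. Math. 84 (1962): §4 (dual lattices, modular components, gluing).
* [Serre1979] J.-P. Serre, *Local Fields*, GTM 67 (1979): Ch. V §3 Prop. 5, Cor. 2–3; Ch. XV §2 (norm groups ∕ conductor); Ch. I §1.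
* [Rogawski1990] J. D. Rogawski, *Automorphic Representations of Unitary Groups in Three Variables*, Ann. of Math. Stud. 123 (1990): §4.9 Prop. 4.9.1 (b) p. 55.
* [Kottwitz1986BaseChangeUnits] R. E. Kottwitz, *Base change for unit elements of Hecke algebras*, Compositio Math. 60 (1986): §1 pp. 240–241.
* [LanglandsShelstad1987] R. P. Langlands, D. Shelstad, *On the definition of transfer factors*, Math. Ann. 278 (1987): §1–§3 (κ-signs on a stable class).
-/

set_option autoImplicit false

noncomputable section

namespace Summit.HodgeConjecture.HodgeConjecture.Cruxes.H413.F0P3cDyRamBoundaryCellLetterCardTwo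

open scoped Valued WithZero Matrix MatrixGroups
open WithZero
open Literature.NumberTheory.Automorphic Literature.NumberTheory.Automorphic.HermitianLattice Literature.NumberTheory.Automorphic.UnitaryLatticeTree
open Literature.NumberTheory.Automorphic.UnitaryThreeFourFrame (IsRamifiedQuadraticDatum)
open Literature.NumberTheory.LocalFields Literature.NumberTheory.LocalFields.WildQuadraticDatum
open Literature.NumberTheory.Rogawski1990
open Summit.HodgeConjecture.HodgeConjecture.Cruxes.H413.F0P3cDyRamToricCensusDefs
open Summit.HodgeConjecture.HodgeConjecture.Cruxes.H413.F0P3cDyRamFourFramePieces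
open Summit.HodgeConjecture.HodgeConjecture.Cruxes.H413.F0P3cDyRamDepthFormLineModel
open Summit.HodgeConjecture.HodgeConjecture.Cruxes.H413.F0P3cDyRamNormFormRayDominated (normFormSet_eq_ray_of_isOrd)
open Summit.HodgeConjecture.HodgeConjecture.Cruxes.H413.F0P3cDyRamDiagonalCellLetter (inv_add_map_inv_eq_map_pairing)
open Summit.HodgeConjecture.HodgeConjecture.Cruxes.H413.F0P3cDyRamBlockGlueLabelFibreConstant (pairing_self_eq_plane_add_line)
open Summit.HodgeConjecture.HodgeConjecture.Cruxes.H413.F0P3cDyRamRayDominatedCellLetter (v_le_iff_v_inv_mul_le_one v_map_le_map_pow_of_le)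
open Summit.HodgeConjecture.HodgeConjecture.Cruxes.H413.F0P3cDyRamFrameEltOneSlotLabel (valueSetMod_smul_xPlus_mul_norm)
open Summit.HodgeConjecture.HodgeConjecture.Cruxes.H413.F0P3cDyRamConeCellFaceAxis (valueSetMod_smul_xPlus_eq_iff_exists_norm)
open Summit.HodgeConjecture.HodgeConjecture.Cruxes.H413.F0P3cDyRamLabelShellFlipCardTwo (valueSetMod_smul_xPlus_eq_twist_of_v_sub_eq_shell)

variable {E M : Type} [Field E] [Valued E ℤᵐ⁰] [Field M] [Valued M ℤᵐ⁰] {ρ Θ : M →+* M} {α : M}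

/-! ## §1 Dyadic trace bookkeeping on `M`; exact transport across `jE`; the glue trace loses a digit off the diagonal -/

omit [Field E] [Valued E ℤᵐ⁰] in
/-- **ANTI-INVARIANT AT LEADING ORDER ⇒ EXACT TRACE (dyadic)**: `ρ` isometric, `|2| < 1`, `|θ − ρθ| = |θ|` ⇒ `|θ + ρθ| = |θ|` (`θ + ρθ = (θ − ρθ) + 2ρθ`).
[cite: Serre1979, Ch. I §1] -/
theorem v_add_map_eq_of_v_sub_map_eq (hvρ : ∀ x, Valued.v (ρ x) = Valued.v x) (h2 : Valued.v (2 : M) < 1) {θ : M}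
    (hθ : Valued.v (θ - ρ θ) = Valued.v θ) : Valued.v (θ + ρ θ) = Valued.v θ := by
  by_cases hθ0 : θ = 0
  · rw [hθ0, map_zero, add_zero]
  have hθv : 0 < Valued.v θ := zero_lt_iff.2 ((Valuation.ne_zero_iff _).2 hθ0)
  have hlt : Valued.v (2 * ρ θ) < Valued.v (θ - ρ θ) := by
    rw [hθ, Valuation.map_mul, hvρ]
    calc Valued.v (2 : M) * Valued.v θ < 1 * Valued.v θ := mul_lt_mul_of_pos_right h2 hθv
      _ = Valued.v θ := one_mul _
  rw [show θ + ρ θ = (θ - ρ θ) + 2 * ρ θ by ring, Valuation.map_add_eq_of_lt_left _ hlt, hθ]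

omit [Field E] [Valued E ℤᵐ⁰] in
/-- **INVARIANT AT LEADING ORDER ⇒ ANTI-INVARIANT TOO (dyadic)**: `|ν + ρν| < |ν|` ⇒ `|ν − ρν| < |ν|` (`ν − ρν = (ν + ρν) − 2ρν`). [cite: Serre1979, Ch. I §1] -/
theorem v_sub_map_lt_of_v_add_map_lt (hvρ : ∀ x, Valued.v (ρ x) = Valued.v x) (h2 : Valued.v (2 : M) < 1) {ν : M}
    (hν : Valued.v (ν + ρ ν) < Valued.v ν) : Valued.v (ν - ρ ν) < Valued.v ν := by
  have hν0 : 0 < Valued.v ν := lt_of_le_of_lt zero_le hν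
  rw [show ν - ρ ν = (ν + ρ ν) - 2 * ρ ν by ring]
  refine lt_of_le_of_lt (Valuation.map_sub _ _ _) (max_lt hν ?_)
  rw [Valuation.map_mul, hvρ]
  calc Valued.v (2 : M) * Valued.v ν < 1 * Valued.v ν := mul_lt_mul_of_pos_right h2 hν0
    _ = Valued.v ν := one_mul _

omit [Field E] [Valued E ℤᵐ⁰] in
/-- **THE DYADIC TRACE LEMMA**: `|θ − ρθ| = |θ|` and `|ν + ρν| < |ν|` ⇒ `|θν + ρ(θν)| = |θ|·|ν|` (`θν + ρ(θν) = ρν·(θ + ρθ) + θ·(ν − ρν)`: the first term is exact, the second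
smaller). [cite: Serre1979, Ch. I §1] [cite: Jacobowitz1962, §4] -/
theorem v_trace_mul_eq_of_anti (hvρ : ∀ x, Valued.v (ρ x) = Valued.v x) (h2 : Valued.v (2 : M) < 1) {θ ν : M}
    (hθ : Valued.v (θ - ρ θ) = Valued.v θ) (hν : Valued.v (ν + ρ ν) < Valued.v ν) :
    Valued.v (θ * ν + ρ (θ * ν)) = Valued.v θ * Valued.v ν := by
  by_cases hθ0 : θ = 0
  · rw [hθ0, zero_mul, map_zero, add_zero, Valuation.map_zero, zero_mul]
  have hθv : 0 < Valued.v θ := zero_lt_iff.2 ((Valuation.ne_zero_iff _).2 hθ0)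
  have hmain : Valued.v (ρ ν * (θ + ρ θ)) = Valued.v θ * Valued.v ν := by
    rw [Valuation.map_mul, hvρ, v_add_map_eq_of_v_sub_map_eq hvρ h2 hθ, mul_comm]
  have hlt : Valued.v (θ * (ν - ρ ν)) < Valued.v (ρ ν * (θ + ρ θ)) := by
    rw [hmain, Valuation.map_mul]
    exact mul_lt_mul_of_pos_left (v_sub_map_lt_of_v_add_map_lt hvρ h2 hν) hθv
  rw [show θ * ν + ρ (θ * ν) = ρ ν * (θ + ρ θ) + θ * (ν - ρ ν) by rw [map_mul]; ring, Valuation.map_add_eq_of_lt_left _ hlt, hmain]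

/-- **EXACT TRANSPORT OF UNITS ACROSS `jE`**: `|jE c| ≤ 1 ↔ |c| ≤ 1` for all `c` ⇒ `|jE c| = 1 ↔ |c| = 1`. [cite: Jacobowitz1962, §4] -/
theorem v_map_eq_one_iff (jE : E →+* M) (hjv : ∀ c, Valued.v (jE c) ≤ 1 ↔ Valued.v c ≤ 1) (c : E) :
    Valued.v (jE c) = 1 ↔ Valued.v c = 1 := by
  by_cases hc : c = 0
  · rw [hc, map_zero, Valuation.map_zero, Valuation.map_zero]
  have h1 := hjv c
  have h2 := hjv c⁻¹
  have hcv : 0 < Valued.v c := zero_lt_iff.2 ((Valuation.ne_zero_iff _).2 hc)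
  have hjcv : 0 < Valued.v (jE c) := zero_lt_iff.2 ((Valuation.ne_zero_iff _).2 ((map_ne_zero jE).2 hc))
  rw [map_inv₀, map_inv₀, map_inv₀, inv_le_one₀ hjcv, inv_le_one₀ hcv] at h2
  constructor
  · intro h; exact le_antisymm (h1.1 h.le) (h2.1 h.ge)
  · intro h; exact le_antisymm (h1.2 h.le) (h2.2 h.ge)

/-- **EXACT TRANSPORT OF A LEVEL ACROSS `jE`**: `|jE x| = |jEϖ|ⁿ ↔ |x| = |ϖ|ⁿ` (`ϖ ≠ 0`). [cite: Jacobowitz1962, §4] -/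
theorem v_map_eq_map_pow_iff (jE : E →+* M) (hjv : ∀ c, Valued.v (jE c) ≤ 1 ↔ Valued.v c ≤ 1) {ϖ : E} (hϖ0 : ϖ ≠ 0) (x : E) (n : ℕ) :
    Valued.v (jE x) = Valued.v (jE ϖ) ^ n ↔ Valued.v x = Valued.v ϖ ^ n := by
  have hϖn : Valued.v (ϖ ^ n) ≠ 0 := (Valuation.ne_zero_iff _).2 (pow_ne_zero _ hϖ0)
  have hjϖn : Valued.v (jE (ϖ ^ n)) ≠ 0 := (Valuation.ne_zero_iff _).2 ((map_ne_zero jE).2 (pow_ne_zero _ hϖ0))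
  have h := v_map_eq_one_iff jE hjv (x * (ϖ ^ n)⁻¹)
  rw [map_mul, map_inv₀, Valuation.map_mul, map_inv₀, Valuation.map_mul, map_inv₀, mul_inv_eq_one₀ hjϖn, mul_inv_eq_one₀ hϖn,
    map_pow, Valuation.map_pow, Valuation.map_pow] at h
  exact h

/-- **STRICT TRANSPORT**: `|jE x| < 1 ↔ |x| < 1`. [cite: Jacobowitz1962, §4] -/
theorem v_map_lt_one_iff_of_le_iff (jE : E →+* M) (hjv : ∀ c, Valued.v (jE c) ≤ 1 ↔ Valued.v c ≤ 1) (x : E) :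
    Valued.v (jE x) < 1 ↔ Valued.v x < 1 := by
  rw [lt_iff_le_and_ne, lt_iff_le_and_ne, hjv x]
  exact and_congr Iff.rfl (v_map_eq_one_iff jE hjv x).not

/-- **OFF THE DIAGONAL THE GLUE TRACE LOSES A DIGIT**: `Tr_ρ(D₀⁻¹) = jE pw` (★ p861637: `pw = ⟨w₀, w₀⟩`), `|pw + σ(g₁)·h_W·g₁| ≤ 1` (integral glue generator), `|ϖ^b·g₁| = 1`,
`|h_W| = 1`, `1 ≤ b`, `σ` isometric, and the conductor gap `|D₀| < |jEϖ|^{2b}` ⇒ `|D₀⁻¹ + ρD₀⁻¹| < |D₀⁻¹|` (`|pw| = |ϖ|^{−2b}`). [cite: Jacobowitz1962, §4]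
[cite: Kottwitz1986BaseChangeUnits, §1 pp. 240–241] -/
theorem v_inv_add_map_inv_lt {σ : E →+* E} (hvσ : ∀ a, Valued.v (σ a) = Valued.v a) (jE : E →+* M) (hjv : ∀ c, Valued.v (jE c) ≤ 1 ↔ Valued.v c ≤ 1)
    {ϖ : E} (hϖ0 : ϖ ≠ 0) (hϖ1 : Valued.v ϖ < 1) {D₀ : M} (hD₀0 : D₀ ≠ 0) {pw g₁ hW : E} (hTr : D₀⁻¹ + ρ D₀⁻¹ = jE pw)
    (hint : Valued.v (pw + σ g₁ * hW * g₁) ≤ 1) {b : ℕ} (hb : 1 ≤ b) (hu : Valued.v (ϖ ^ b * g₁) = 1) (hh : Valued.v hW = 1)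
    (hgap : Valued.v D₀ < Valued.v (jE ϖ) ^ (2 * b)) :
    Valued.v (D₀⁻¹ + ρ D₀⁻¹) < Valued.v D₀⁻¹ := by
  have hvϖ0 : Valued.v ϖ ≠ 0 := (Valuation.ne_zero_iff _).2 hϖ0
  have hpb : Valued.v (ϖ ^ b) ≠ 0 := (Valuation.ne_zero_iff _).2 (pow_ne_zero _ hϖ0)
  have hg₁ : Valued.v g₁ = (Valued.v (ϖ ^ b))⁻¹ := by
    rw [Valuation.map_mul] at hu; exact eq_inv_of_mul_eq_one_right hu
  -- `|σ(g₁)·h_W·g₁| = |ϖ|^{−2b} > 1`, so `|pw| = |ϖ|^{−2b}`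
  have hs : Valued.v (σ g₁ * hW * g₁) = (Valued.v (ϖ ^ (2 * b)))⁻¹ := by
    rw [Valuation.map_mul, Valuation.map_mul, hvσ, hh, hg₁, mul_one, ← mul_inv, ← Valuation.map_mul, ← pow_add, two_mul]
  have hs1 : 1 < Valued.v (σ g₁ * hW * g₁) := by
    rw [hs, one_lt_inv₀ (zero_lt_iff.2 ((Valuation.ne_zero_iff _).2 (pow_ne_zero _ hϖ0))), Valuation.map_pow]
    exact pow_lt_one₀ zero_le hϖ1 (by omega)
  have hpw : Valued.v pw = (Valued.v (ϖ ^ (2 * b)))⁻¹ := by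
    have hlt : Valued.v (pw + σ g₁ * hW * g₁) < Valued.v (σ g₁ * hW * g₁) := lt_of_le_of_lt hint hs1
    have e : pw = -(σ g₁ * hW * g₁) + (pw + σ g₁ * hW * g₁) := by ring
    rw [e, Valuation.map_add_eq_of_lt_left _ (by rw [Valuation.map_neg]; exact hlt), Valuation.map_neg, hs]
  -- transport: `|jE pw| = |jEϖ^{2b}|⁻¹`
  have hpw1 : Valued.v (pw * ϖ ^ (2 * b)) = 1 := by
    rw [Valuation.map_mul, hpw, inv_mul_cancel₀ ((Valuation.ne_zero_iff _).2 (pow_ne_zero _ hϖ0))]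
  have hjpw1 : Valued.v (jE pw) * Valued.v (jE ϖ) ^ (2 * b) = 1 := by
    rw [← Valuation.map_pow, ← map_pow, ← Valuation.map_mul, ← map_mul]; exact (v_map_eq_one_iff jE hjv _).2 hpw1
  have hjϖ0 : (0 : ℤᵐ⁰) < Valued.v (jE ϖ) ^ (2 * b) := zero_lt_iff.2 (pow_ne_zero _ ((Valuation.ne_zero_iff _).2 ((map_ne_zero jE).2 hϖ0)))
  have hjpw : Valued.v (jE pw) = (Valued.v (jE ϖ) ^ (2 * b))⁻¹ := eq_inv_of_mul_eq_one_left hjpw1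
  rw [hTr, hjpw, map_inv₀, inv_lt_inv₀ hjϖ0 (zero_lt_iff.2 ((Valuation.ne_zero_iff _).2 hD₀0))]
  exact hgap

/-! ## §2 The exact size of the boundary correction -/

/-- **THE EXACT SIZE — `|Tr_ρ(μ∕D₀) − jE(f·h_W·(t·N(ϖ^b g₁)))| = |jEϖ|ⁿ` ONE DIGIT SHORT.**  Letters of ★ p861810 §1 (`ρ` fixes `jE(E)`, isometric; `D₀ ≠ 0`, `D₀⁻¹ + ρD₀⁻¹ = jE pw`;
`|pw + σ(g₁)·h_W·g₁| ≤ 1`; `|jE(f·t·(ϖσϖ)^b)| ≤ |jEϖ|^m`) PLUS: `|2| < 1`, `|jEϖ| < 1`, `n < m`, the trace of `D₀⁻¹` loses a digit (`|D₀⁻¹ + ρD₀⁻¹| < |D₀⁻¹|`, §1), and the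
BOUNDARY letters `hlam′ : |μ + jE(f·t·(ϖσϖ)^b)| ≤ |jEϖ|ⁿ·|D₀|`, `hjl : |μ − ρμ| = |jEϖ|ⁿ·|D₀|`.  THEN `|μ∕D₀ + ρ(μ∕D₀) − jE(f·h_W·(t·N(ϖ^b·g₁)))| = |jEϖ|ⁿ` EXACTLY:
with `θ = μ + jE F` one has `|θ − ρθ| = |θ|`, `Tr_ρ(μ∕D₀) − jE(main) = Tr_ρ(θ∕D₀) − jE(F)·jE(pw + σg₁·h_W·g₁)`, the first of exact size `|jEϖ|ⁿ` (§1), the second `≤ |jEϖ|^m`.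
[cite: Jacobowitz1962, §4] [cite: Kottwitz1986BaseChangeUnits, §1 pp. 240–241] [cite: Rogawski1990, §4.9 Prop. 4.9.1 (b) p. 55] -/
theorem v_trace_div_sub_main_eq (σ : E →+* E) (jE : E →+* M) (hjv : ∀ c, Valued.v (jE c) ≤ 1 ↔ Valued.v c ≤ 1) (hρj : ∀ c, ρ (jE c) = jE c)
    (hvρ : ∀ x, Valued.v (ρ x) = Valued.v x) (h2 : Valued.v (2 : M) < 1) {D₀ : M} (hD₀0 : D₀ ≠ 0) {pw : E} (hTr : D₀⁻¹ + ρ D₀⁻¹ = jE pw)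
    (hν : Valued.v (D₀⁻¹ + ρ D₀⁻¹) < Valued.v D₀⁻¹) {g₁ hW : E} (hint : Valued.v (pw + σ g₁ * hW * g₁) ≤ 1)
    {ϖ : E} (hϖ0 : ϖ ≠ 0) (hjϖ1 : Valued.v (jE ϖ) < 1) {m n b : ℕ} (hnm : n < m) {f t : E}
    (hcm : Valued.v (jE (f * t * (ϖ * σ ϖ) ^ b)) ≤ Valued.v (jE ϖ) ^ m)
    {μ : M} (hlam : Valued.v (μ + jE (f * t * (ϖ * σ ϖ) ^ b)) ≤ Valued.v (jE ϖ) ^ n * Valued.v D₀)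
    (hjl : Valued.v (μ - ρ μ) = Valued.v (jE ϖ) ^ n * Valued.v D₀) :
    Valued.v (μ / D₀ + ρ (μ / D₀) - jE (f * hW * (t * ((ϖ ^ b * g₁) * σ (ϖ ^ b * g₁))))) = Valued.v (jE ϖ) ^ n := by
  obtain ⟨θ, rfl⟩ : ∃ θ : M, μ = θ - jE (f * t * (ϖ * σ ϖ) ^ b) := ⟨μ + jE (f * t * (ϖ * σ ϖ) ^ b), by ring⟩
  rw [sub_add_cancel] at hlam
  set J : M := jE (f * t * (ϖ * σ ϖ) ^ b) with hJ
  have hρJ : ρ J = J := hρj _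
  have hD₀v : Valued.v D₀ ≠ 0 := (Valuation.ne_zero_iff _).2 hD₀0
  have hjϖpos : (0 : ℤᵐ⁰) < Valued.v (jE ϖ) := zero_lt_iff.2 ((Valuation.ne_zero_iff _).2 ((map_ne_zero jE).2 hϖ0))
  -- `|θ − ρθ| = |θ|`
  have hθρ : θ - J - ρ (θ - J) = θ - ρ θ := by rw [map_sub, hρJ]; ring
  rw [hθρ] at hjl
  have hθ : Valued.v (θ - ρ θ) = Valued.v θ := by
    apply le_antisymm
    · exact (Valuation.map_sub _ _ _).trans (max_le le_rfl (by rw [hvρ]))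
    · rw [hjl]; exact hlam
  have hθv : Valued.v θ = Valued.v (jE ϖ) ^ n * Valued.v D₀ := by rw [← hθ, hjl]
  -- the exact trace of `θ∕D₀`
  have hT : Valued.v (θ * D₀⁻¹ + ρ (θ * D₀⁻¹)) = Valued.v (jE ϖ) ^ n := by
    rw [v_trace_mul_eq_of_anti hvρ h2 hθ hν, hθv, map_inv₀, mul_assoc, mul_inv_cancel₀ hD₀v, mul_one]
  -- the main term through `pw` (★ p861810 §1)
  have hmain : f * hW * (t * ((ϖ ^ b * g₁) * σ (ϖ ^ b * g₁))) =
      f * t * (ϖ * σ ϖ) ^ b * (pw + σ g₁ * hW * g₁) - f * t * (ϖ * σ ϖ) ^ b * pw := by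
    rw [map_mul, map_pow]; ring
  have hMn : jE (f * hW * (t * ((ϖ ^ b * g₁) * σ (ϖ ^ b * g₁)))) = J * jE (pw + σ g₁ * hW * g₁) - J * (D₀⁻¹ + ρ D₀⁻¹) := by
    rw [hTr, hJ, ← map_mul, ← map_mul, ← map_sub, hmain]
  set I : M := jE (pw + σ g₁ * hW * g₁) with hI
  have hsplit : (θ - J) / D₀ + ρ ((θ - J) / D₀) - (J * I - J * (D₀⁻¹ + ρ D₀⁻¹)) = (θ * D₀⁻¹ + ρ (θ * D₀⁻¹)) + -(J * I) := by
    simp only [div_eq_mul_inv, map_sub, map_mul, map_inv₀, hρJ]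
    ring
  rw [hMn, hsplit]
  have hlt : Valued.v (-(J * I)) < Valued.v (θ * D₀⁻¹ + ρ (θ * D₀⁻¹)) := by
    rw [hT, Valuation.map_neg, Valuation.map_mul]
    calc Valued.v J * Valued.v I ≤ Valued.v (jE ϖ) ^ m * 1 := mul_le_mul' hcm ((hjv _).2 hint)
      _ = Valued.v (jE ϖ) ^ m := mul_one _
      _ < Valued.v (jE ϖ) ^ n := pow_lt_pow_right_of_lt_one₀ hjϖpos hjϖ1 hnm
  rw [Valuation.map_add_eq_of_lt_left _ hlt, hT]

/-! ## §3 HEAD — one digit short of the clean scale the letter is the twist `(c·f·h_W) • X₊` -/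

/-- **HEAD — «THE LETTER OF A BOUNDARY CELL IS THE c-TWIST `(c·f·h_W) • X₊`».**  Frame of ★ p861810 `valueSet_endoGL_sub_one_glued_eq_smul_xPlus_of_isOrd` VERBATIM (★ p861372
HEAD B letters: the plane `(E², H₂)`, block form `block(H₂, h_W)`, `Γ = endoGL (γ₂, u)`; ★ (C1)'s line model `(M, jE, ρ, Θ; φ, lam, h_M)`; the INTEGRAL vertex `L` glued over
`(B₂, w₀)` with generator `g₀`, `|g₀ 1|·|ϖ|^b = 1`; the presentation `φ(B₂) = Λ = x₀·𝒪_cc`, `φ w₀ = Y⁻¹x₀`, `Y = dualGen ρ Θ α cc h_M x₀`; the `ρ`∕`Θ`∕order letters; the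
RAY-DOMINATION letters `hYO hμ hμt hmm` of ★ p861653; `m* ≤ 2b`) at the label modulus `m = m* = mstarOfRecord d` with `|u₀₀ − 1| ≤ |ϖ^{m*}|`, over the wild `q = 2` frame
(`hD : IsRamifiedQuadraticDatum σ ϖ d t_E`, `|2| < 1`, `#𝓀[E] = 2`, `d` even), with `σf = f`, `|f| = 1`, `σh_W = h_W`, `|h_W| = 1`, and with ★ p861810's `hlam` REPLACED by the
BOUNDARY letters: `hlam′ : |μ + jE(f·t₊·(ϖσϖ)^b)| ≤ |jEϖ|^{m*−1}·|D₀|`, `hjl : |μ − ρμ| = |jEϖ|^{m*−1}·|D₀|` (`δ = c + m* − 1` EXACTLY), `hgap : |D₀| < |jEϖ|^{2b}` (conductor gap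
`c ≥ 1`), where `μ = lam − jE u₀₀`, `D₀ = cc(α − ρα)·ΘY`, `t₊ = (ϖ − σϖ)·((ϖσϖ)^{⌊d∕2⌋})⁻¹`.  THEN for every σ-fixed non-norm unit `c` the `ϖ^{m*}`-value set of `Γ − 1` on `L` is
`valueSetMod σ ϖ m* ((c·(f·h_W)) • xPlus σ ϖ d)` — the OPPOSITE label class of the clean cells' letter `(f·h_W) • X₊`.  (★ HEAD B → ★ p861653 ray letter `(e₀·t₊⁻¹) • X₊` → §2
`|e₀ − f·h_W·t₊·N(ϖ^b g₀1)| = |ϖ|^{2(d−1)}` → ★ p861900 (S1) → ★ `valueSetMod_smul_xPlus_mul_norm`.) [cite: Jacobowitz1962, §4] [cite: Rogawski1990, §4.9 Prop. 4.9.1 (b) p. 55]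
[cite: Kottwitz1986BaseChangeUnits, §1 pp. 240–241] [cite: Serre1979, Ch. V §3 Prop. 5, Cor. 2–3] [cite: LanglandsShelstad1987, §1–§3] -/
theorem valueSet_endoGL_sub_one_glued_eq_twist_smul_xPlus_of_boundary [CompleteSpace E] [Fintype 𝓀[E]]
    {σ : E →+* E} {ϖ : E} {d tE : ℕ} (hD : IsRamifiedQuadraticDatum σ ϖ d tE) (h2v : Valued.v (2 : E) < 1) (hq : Fintype.card 𝓀[E] = 2) (hd2 : d % 2 = 0)
    (H₂ : Matrix (Fin 2) (Fin 2) E) {h : E} (hσh : σ h = h) (hh1 : Valued.v h = 1)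
    (jE : E →+* M) (hjv : ∀ c, Valued.v (jE c) ≤ 1 ↔ Valued.v c ≤ 1) (hjfix : ∀ z, ρ z = z ↔ ∃ c, jE c = z)
    (hρρ : ∀ x, ρ (ρ x) = x) (hvρ : ∀ x, Valued.v (ρ x) = Valued.v x) (hα : ρ α ≠ α) (hα1 : Valued.v α ≤ 1)
    (hintρ : ∀ z : M, Valued.v z ≤ 1 → Valued.v ((z - ρ z) / (α - ρ α)) ≤ 1)
    (hΘΘ : ∀ x, Θ (Θ x) = x) (hΘρ : ∀ x, Θ (ρ x) = ρ (Θ x)) (hvΘ : ∀ x, Valued.v (Θ x) = Valued.v x) (hΘj : ∀ c, Θ (jE c) = jE (σ c))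
    (φ : (Fin 2 → E) →+ M) (hφs : ∀ (c : E) (x : Fin 2 → E), φ (c • x) = jE c * φ x)
    {γ₂ : GL (Fin 2) E} {lam hM : M} (hφγ : ∀ x, φ ((γ₂ : Matrix (Fin 2) (Fin 2) E) *ᵥ x) = lam * φ x) (hhM : hM ≠ 0) (hΘh : Θ hM = hM)
    (hform : ∀ x y, jE (pairing σ H₂ x y) = hM * Θ (φ x) * φ y + ρ (hM * Θ (φ x) * φ y))
    {L : Submodule 𝒪[E] (Fin 3 → E)} {b : ℕ} (hpr : ∀ x ∈ L, Valued.v (x 1) * Valued.v ϖ ^ b ≤ 1)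
    (hint : ∀ y ∈ L, Valued.v (pairing σ (!![H₂ 0 0, 0, H₂ 0 1; 0, h, 0; H₂ 1 0, 0, H₂ 1 1] : Matrix (Fin 3) (Fin 3) E) y y) ≤ 1)
    {B₂ : Submodule 𝒪[E] (Fin 2 → E)} {w₀ : Fin 2 → E} {g₀ : Fin 3 → E}
    (hB : B₂.map ((Matrix.toLin' (!![1, 0; 0, 0; 0, 1] : Matrix (Fin 3) (Fin 2) E)).restrictScalars 𝒪[E]) =
      L ⊓ LinearMap.ker ((LinearMap.proj (1 : Fin 3) : (Fin 3 → E) →ₗ[E] E).restrictScalars 𝒪[E]))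
    (hg₀ : g₀ ∈ L) (hg₀1 : Valued.v (g₀ 1) * Valued.v ϖ ^ b = 1) (hprg : g₀ - Pi.single 1 (g₀ 1) = ![w₀ 0, 0, w₀ 1])
    (u : GL (Fin 1) E) (hum : Valued.v ((u : Matrix (Fin 1) (Fin 1) E) 0 0 - 1) ≤ Valued.v (ϖ ^ mstarOfRecord d))
    {cc x₀ : M} (hc : ρ cc = cc) (hc0 : cc ≠ 0) (hc1 : Valued.v cc ≤ 1) (hcc : cc * (α - ρ α) ≠ 0) (hx₀ : x₀ ≠ 0)
    {Λ : AddSubgroup M} (hBΛ : B₂.toAddSubgroup.map φ = Λ)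
    (hΛx : ∀ x, x ∈ Λ ↔ ∃ ζ, IsOrd ρ α cc ζ ∧ x = x₀ * ζ) (hw₀Y : φ w₀ = (dualGen ρ Θ α cc hM x₀)⁻¹ * x₀)
    (hYO : IsOrd ρ α cc (dualGen ρ Θ α cc hM x₀))
    {μt : M} {m' : ℕ} (hμ : lam - jE ((u : Matrix (Fin 1) (Fin 1) E) 0 0) = jE (ϖ ^ m') * μt) (hμt : IsOrd ρ α cc μt)
    (hmm : mstarOfRecord d ≤ m') (hmb : mstarOfRecord d ≤ 2 * b) {f : E} (hσf : σ f = f) (hf1 : Valued.v f = 1)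
    (hlam : Valued.v (lam - jE ((u : Matrix (Fin 1) (Fin 1) E) 0 0) + jE (f * ((ϖ - σ ϖ) * ((ϖ * σ ϖ) ^ ((d - d % 2) / 2))⁻¹) * (ϖ * σ ϖ) ^ b)) ≤
      Valued.v (jE ϖ) ^ (mstarOfRecord d - 1) * Valued.v (cc * (α - ρ α) * Θ (dualGen ρ Θ α cc hM x₀)))
    (hjl : Valued.v ((lam - jE ((u : Matrix (Fin 1) (Fin 1) E) 0 0)) - ρ (lam - jE ((u : Matrix (Fin 1) (Fin 1) E) 0 0))) =
      Valued.v (jE ϖ) ^ (mstarOfRecord d - 1) * Valued.v (cc * (α - ρ α) * Θ (dualGen ρ Θ α cc hM x₀)))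
    (hgap : Valued.v (cc * (α - ρ α) * Θ (dualGen ρ Θ α cc hM x₀)) < Valued.v (jE ϖ) ^ (2 * b))
    {c : E} (hσc : σ c = c) (hcu : Valued.v c = 1) (hcN : ¬ ∃ z : E, z * σ z = c) :
    {z : E | ∃ y ∈ L, Valued.v ((ϖ ^ mstarOfRecord d)⁻¹ * (z - pairing σ (!![H₂ 0 0, 0, H₂ 0 1; 0, h, 0; H₂ 1 0, 0, H₂ 1 1] : Matrix (Fin 3) (Fin 3) E) y
        ((((endoGL (γ₂, u) : GL (Fin 3) E) : Matrix (Fin 3) (Fin 3) E) - 1) *ᵥ y))) ≤ 1} =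
      valueSetMod σ ϖ (mstarOfRecord d) ((c * (f * h)) • xPlus σ ϖ d) := by
  obtain ⟨hσσ, hvσ, hϖ, hfix, hdd, h1d, ht2⟩ := id hD
  -- names
  set m : ℕ := mstarOfRecord d with hmdef
  set Y : M := dualGen ρ Θ α cc hM x₀ with hYdef
  set D₀ : M := cc * (α - ρ α) * Θ Y with hD₀def
  set μ : M := lam - jE ((u : Matrix (Fin 1) (Fin 1) E) 0 0) with hμdef
  set t : E := (ϖ - σ ϖ) * ((ϖ * σ ϖ) ^ ((d - d % 2) / 2))⁻¹ with htdef
  have h2d : 2 ≤ d := two_le_of_v_two_lt_one hσσ hvσ hfix hϖ hdd ht2 h2v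
  have hm : m = 2 * (d - 1) + 1 := by
    show d % 2 + 2 * d - 1 = 2 * (d - 1) + 1
    omega
  have hn : m - 1 = 2 * (d - 1) := by omega
  have hb : 1 ≤ b := by omega
  have hvϖ0 : Valued.v ϖ ≠ 0 := by rw [hϖ]; exact WithZero.exp_ne_zero
  have hϖ0 : ϖ ≠ 0 := fun h0 => by rw [h0, map_zero] at hvϖ0; exact hvϖ0 rfl
  have hϖlt : Valued.v ϖ < 1 := by rw [hϖ, ← WithZero.exp_zero, WithZero.exp_lt_exp]; norm_num
  have hϖ1 : Valued.v ϖ ≤ 1 := hϖlt.le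
  have hρj : ∀ c : E, ρ (jE c) = jE c := fun c => (hjfix _).2 ⟨c, rfl⟩
  have hY0 : Y ≠ 0 := by
    rw [hYdef, dualGen_def]; exact mul_ne_zero (mul_ne_zero hhM (mul_ne_zero hx₀ ((map_ne_zero Θ).2 hx₀))) hcc
  have hD₀0 : D₀ ≠ 0 := mul_ne_zero hcc ((map_ne_zero Θ).2 hY0)
  have hjϖ1 : Valued.v (jE ϖ) < 1 := (v_map_lt_one_iff_of_le_iff jE hjv ϖ).2 hϖlt
  have h2M : Valued.v (2 : M) < 1 := by
    have h := (v_map_lt_one_iff_of_le_iff jE hjv 2).2 h2v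
    rwa [map_ofNat] at h
  -- `|t₊| = 1` (d even)
  have ht1 : Valued.v t = 1 := by
    have hdd' : 2 * ((d - d % 2) / 2) = d := by omega
    rw [htdef, Valuation.map_mul, map_inv₀, hdd, Valuation.map_pow, Valuation.map_mul, hvσ, ← pow_two, ← pow_mul, hdd',
      mul_inv_cancel₀ (pow_ne_zero _ hvϖ0)]
  have ht0 : t ≠ 0 := fun h0 => by rw [h0, map_zero] at ht1; exact zero_ne_one ht1
  -- the glue letters: `Tr_ρ(D₀⁻¹) = jE⟨w₀,w₀⟩`, integrality of `g₀`, the unit `ϖ^b·g₀ 1`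
  have hTr : D₀⁻¹ + ρ D₀⁻¹ = jE (pairing σ H₂ w₀ w₀) := inv_add_map_inv_eq_map_pairing σ H₂ jE hΘΘ φ hhM hform hcc hx₀ hw₀Y
  have hw₀g : (![g₀ 0, g₀ 2] : Fin 2 → E) = w₀ := by
    have h0 := congrFun hprg 0
    have h2 := congrFun hprg 2
    ext i; fin_cases i
    · simpa using h0
    · simpa using h2
  have hintg : Valued.v (pairing σ H₂ w₀ w₀ + σ (g₀ 1) * h * g₀ 1) ≤ 1 := by
    have h1 := hint g₀ hg₀
    rwa [pairing_self_eq_plane_add_line σ H₂ h g₀, hw₀g] at h1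
  have hu₀ : Valued.v (ϖ ^ b * g₀ 1) = 1 := by rw [Valuation.map_mul, Valuation.map_pow, mul_comm]; exact hg₀1
  -- off the diagonal the glue trace loses a digit
  have hν : Valued.v (D₀⁻¹ + ρ D₀⁻¹) < Valued.v D₀⁻¹ := v_inv_add_map_inv_lt hvσ jE hjv hϖ0 hϖlt hD₀0 hTr hintg hb hu₀ hh1 hgap
  -- `|jE(f·t·(ϖσϖ)^b)| ≤ |jEϖ|^m` from `|f t| = 1`, `m ≤ 2b`
  have hcm : Valued.v (jE (f * t * (ϖ * σ ϖ) ^ b)) ≤ Valued.v (jE ϖ) ^ m := by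
    refine v_map_le_map_pow_of_le jE hjv hϖ0 ?_
    have hϖσ : Valued.v ((ϖ * σ ϖ) ^ b) = Valued.v ϖ ^ (2 * b) := by
      rw [Valuation.map_pow, Valuation.map_mul, hvσ, ← pow_two, ← pow_mul]
    rw [Valuation.map_mul, hϖσ, Valuation.map_mul, hf1, ht1, one_mul, one_mul]
    exact pow_le_pow_right_of_le_one' hϖ1 hmb
  -- HEAD B: the value set is the norm-form set
  rw [valueSet_endoGL_sub_one_glued_eq_normFormSet_of_gen σ hϖ H₂ h jE hjv hΘΘ φ hφs hφγ hhM hform hpr hint hB hg₀ hg₀1 hprg u m hum hcc hx₀ hBΛ hΛx hw₀Y]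
  -- the ray scalar `e₀` (`jE e₀ = Tr_ρ(μ∕D₀)`) and the ray letter (★ p861653)
  have hρT : ρ (μ / D₀ + ρ (μ / D₀)) = μ / D₀ + ρ (μ / D₀) := by rw [map_add, hρρ, add_comm]
  obtain ⟨e₀, he₀⟩ := (hjfix _).1 hρT
  have hray := normFormSet_eq_ray_of_isOrd hρρ hvρ hα hα1 hintρ hΘΘ hΘρ hvΘ hc hc0 hc1 hcc hhM hΘh hx₀ hΛx hYO hvσ hϖ hdd jE hjv hΘj hjfix hμ hμt hmm he₀
  -- §2: `e₀` sits at distance EXACTLY `|ϖ|^{2(d−1)}` from `f·h·t·N(ϖ^b g₀1)`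
  have hX := v_trace_div_sub_main_eq σ jE hjv hρj hvρ h2M hD₀0 hTr hν hintg hϖ0 hjϖ1 (show m - 1 < m by omega) hcm hlam hjl
  rw [← he₀, ← map_sub, v_map_eq_map_pow_iff jE hjv hϖ0, hn] at hX
  -- the two scalars of ★ p861900 (S1): `g = e₀·t⁻¹`, `e′ = f·h·N(ϖ^b g₀1)`
  set u₁ : E := ϖ ^ b * g₀ 1 with hu₁
  have hσe' : σ (f * h * (u₁ * σ u₁)) = f * h * (u₁ * σ u₁) := by rw [map_mul, map_mul, map_mul, hσf, hσh, hσσ, mul_comm (σ u₁) u₁]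
  have he'1 : Valued.v (f * h * (u₁ * σ u₁)) = 1 := by
    rw [Valuation.map_mul, Valuation.map_mul, Valuation.map_mul, hf1, hh1, hvσ, hu₀]; simp only [mul_one]
  have hge' : Valued.v (e₀ * t⁻¹ - f * h * (u₁ * σ u₁)) = Valued.v ϖ ^ (2 * (d - 1)) := by
    rw [show e₀ * t⁻¹ - f * h * (u₁ * σ u₁) = (e₀ - f * h * (t * (u₁ * σ u₁))) * t⁻¹ by field_simp, Valuation.map_mul, map_inv₀, ht1,
      inv_one, mul_one, hX]
  have hS1 := valueSetMod_smul_xPlus_eq_twist_of_v_sub_eq_shell hD h2v hq hd2 hσe' he'1 hge' hσc hcu hcN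
  have hfin : valueSetMod σ ϖ m ((e₀ * t⁻¹) • xPlus σ ϖ d) = valueSetMod σ ϖ m ((c * (f * h)) • xPlus σ ϖ d) := by
    rw [hS1, show c * (f * h * (u₁ * σ u₁)) = (c * (f * h)) * (u₁ * σ u₁) by ring, valueSetMod_smul_xPlus_mul_norm σ ϖ d m (c * (f * h)) hu₀]
  rw [← hfin, ← hray]
  ext z
  simp only [Set.mem_setOf_eq, mul_div_right_comm]
  exact Iff.rfl

/-- **COROLLARY — «NOT THE CLEAN LETTER»**: under the hypotheses of the HEAD (no `c` needed), the `ϖ^{m*}`-value set of `Γ − 1` on `L` is NOT `valueSetMod σ ϖ m* ((f·h_W) • X₊)` —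
the boundary cell and the clean cells (★ p861810) carry OPPOSITE labels at the same literal (★ `exists_fixed_unit_not_norm_v_sub_one_le` supplies a non-norm `c`; HEAD; ★ p861154
`valueSetMod_smul_xPlus_eq_iff_exists_norm` would make `c` a norm). [cite: Serre1979, Ch. V §3 Prop. 5, Cor. 2–3] [cite: Rogawski1990, §4.9 Prop. 4.9.1 (b) p. 55] -/
theorem valueSet_endoGL_sub_one_glued_ne_smul_xPlus_of_boundary [CompleteSpace E] [Fintype 𝓀[E]]
    {σ : E →+* E} {ϖ : E} {d tE : ℕ} (hD : IsRamifiedQuadraticDatum σ ϖ d tE) (h2v : Valued.v (2 : E) < 1) (hq : Fintype.card 𝓀[E] = 2) (hd2 : d % 2 = 0)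
    (H₂ : Matrix (Fin 2) (Fin 2) E) {h : E} (hσh : σ h = h) (hh1 : Valued.v h = 1)
    (jE : E →+* M) (hjv : ∀ c, Valued.v (jE c) ≤ 1 ↔ Valued.v c ≤ 1) (hjfix : ∀ z, ρ z = z ↔ ∃ c, jE c = z)
    (hρρ : ∀ x, ρ (ρ x) = x) (hvρ : ∀ x, Valued.v (ρ x) = Valued.v x) (hα : ρ α ≠ α) (hα1 : Valued.v α ≤ 1)
    (hintρ : ∀ z : M, Valued.v z ≤ 1 → Valued.v ((z - ρ z) / (α - ρ α)) ≤ 1)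
    (hΘΘ : ∀ x, Θ (Θ x) = x) (hΘρ : ∀ x, Θ (ρ x) = ρ (Θ x)) (hvΘ : ∀ x, Valued.v (Θ x) = Valued.v x) (hΘj : ∀ c, Θ (jE c) = jE (σ c))
    (φ : (Fin 2 → E) →+ M) (hφs : ∀ (c : E) (x : Fin 2 → E), φ (c • x) = jE c * φ x)
    {γ₂ : GL (Fin 2) E} {lam hM : M} (hφγ : ∀ x, φ ((γ₂ : Matrix (Fin 2) (Fin 2) E) *ᵥ x) = lam * φ x) (hhM : hM ≠ 0) (hΘh : Θ hM = hM)
    (hform : ∀ x y, jE (pairing σ H₂ x y) = hM * Θ (φ x) * φ y + ρ (hM * Θ (φ x) * φ y))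
    {L : Submodule 𝒪[E] (Fin 3 → E)} {b : ℕ} (hpr : ∀ x ∈ L, Valued.v (x 1) * Valued.v ϖ ^ b ≤ 1)
    (hint : ∀ y ∈ L, Valued.v (pairing σ (!![H₂ 0 0, 0, H₂ 0 1; 0, h, 0; H₂ 1 0, 0, H₂ 1 1] : Matrix (Fin 3) (Fin 3) E) y y) ≤ 1)
    {B₂ : Submodule 𝒪[E] (Fin 2 → E)} {w₀ : Fin 2 → E} {g₀ : Fin 3 → E}
    (hB : B₂.map ((Matrix.toLin' (!![1, 0; 0, 0; 0, 1] : Matrix (Fin 3) (Fin 2) E)).restrictScalars 𝒪[E]) =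
      L ⊓ LinearMap.ker ((LinearMap.proj (1 : Fin 3) : (Fin 3 → E) →ₗ[E] E).restrictScalars 𝒪[E]))
    (hg₀ : g₀ ∈ L) (hg₀1 : Valued.v (g₀ 1) * Valued.v ϖ ^ b = 1) (hprg : g₀ - Pi.single 1 (g₀ 1) = ![w₀ 0, 0, w₀ 1])
    (u : GL (Fin 1) E) (hum : Valued.v ((u : Matrix (Fin 1) (Fin 1) E) 0 0 - 1) ≤ Valued.v (ϖ ^ mstarOfRecord d))
    {cc x₀ : M} (hc : ρ cc = cc) (hc0 : cc ≠ 0) (hc1 : Valued.v cc ≤ 1) (hcc : cc * (α - ρ α) ≠ 0) (hx₀ : x₀ ≠ 0)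
    {Λ : AddSubgroup M} (hBΛ : B₂.toAddSubgroup.map φ = Λ)
    (hΛx : ∀ x, x ∈ Λ ↔ ∃ ζ, IsOrd ρ α cc ζ ∧ x = x₀ * ζ) (hw₀Y : φ w₀ = (dualGen ρ Θ α cc hM x₀)⁻¹ * x₀)
    (hYO : IsOrd ρ α cc (dualGen ρ Θ α cc hM x₀))
    {μt : M} {m' : ℕ} (hμ : lam - jE ((u : Matrix (Fin 1) (Fin 1) E) 0 0) = jE (ϖ ^ m') * μt) (hμt : IsOrd ρ α cc μt)
    (hmm : mstarOfRecord d ≤ m') (hmb : mstarOfRecord d ≤ 2 * b) {f : E} (hσf : σ f = f) (hf1 : Valued.v f = 1)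
    (hlam : Valued.v (lam - jE ((u : Matrix (Fin 1) (Fin 1) E) 0 0) + jE (f * ((ϖ - σ ϖ) * ((ϖ * σ ϖ) ^ ((d - d % 2) / 2))⁻¹) * (ϖ * σ ϖ) ^ b)) ≤
      Valued.v (jE ϖ) ^ (mstarOfRecord d - 1) * Valued.v (cc * (α - ρ α) * Θ (dualGen ρ Θ α cc hM x₀)))
    (hjl : Valued.v ((lam - jE ((u : Matrix (Fin 1) (Fin 1) E) 0 0)) - ρ (lam - jE ((u : Matrix (Fin 1) (Fin 1) E) 0 0))) =
      Valued.v (jE ϖ) ^ (mstarOfRecord d - 1) * Valued.v (cc * (α - ρ α) * Θ (dualGen ρ Θ α cc hM x₀)))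
    (hgap : Valued.v (cc * (α - ρ α) * Θ (dualGen ρ Θ α cc hM x₀)) < Valued.v (jE ϖ) ^ (2 * b)) :
    {z : E | ∃ y ∈ L, Valued.v ((ϖ ^ mstarOfRecord d)⁻¹ * (z - pairing σ (!![H₂ 0 0, 0, H₂ 0 1; 0, h, 0; H₂ 1 0, 0, H₂ 1 1] : Matrix (Fin 3) (Fin 3) E) y
        ((((endoGL (γ₂, u) : GL (Fin 3) E) : Matrix (Fin 3) (Fin 3) E) - 1) *ᵥ y))) ≤ 1} ≠
      valueSetMod σ ϖ (mstarOfRecord d) ((f * h) • xPlus σ ϖ d) := by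
  obtain ⟨hσσ, hvσ, hϖ, hfix, hdd, h1d, ht2⟩ := id hD
  haveI := Literature.NumberTheory.LocalFields.isAdicComplete_valuedInteger_of_completeSpace (K := E) hϖ
  obtain ⟨c, hσc, hcu, -, hcN⟩ := exists_fixed_unit_not_norm_v_sub_one_le hD h2v
  rw [valueSet_endoGL_sub_one_glued_eq_twist_smul_xPlus_of_boundary hD h2v hq hd2 H₂ hσh hh1 jE hjv hjfix hρρ hvρ hα hα1 hintρ hΘΘ hΘρ hvΘ hΘj φ hφs hφγ hhM
    hΘh hform hpr hint hB hg₀ hg₀1 hprg u hum hc hc0 hc1 hcc hx₀ hBΛ hΛx hw₀Y hYO hμ hμt hmm hmb hσf hf1 hlam hjl hgap hσc hcu hcN]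
  intro hEq
  have hσfh : σ (f * h) = f * h := by rw [map_mul, hσf, hσh]
  have hfh1 : Valued.v (f * h) = 1 := by rw [Valuation.map_mul, hf1, hh1, one_mul]
  have hfh0 : f * h ≠ 0 := fun h0 => by rw [h0, map_zero] at hfh1; exact zero_ne_one hfh1
  have hσcfh : σ (c * (f * h)) = c * (f * h) := by rw [map_mul, hσc, hσfh]
  have hcfh1 : Valued.v (c * (f * h)) = 1 := by rw [Valuation.map_mul, hcu, hfh1, one_mul]
  obtain ⟨z, hz⟩ := (valueSetMod_smul_xPlus_eq_iff_exists_norm hD hσcfh hcfh1 hσfh hfh1).1 hEq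
  exact hcN ⟨z, by rw [hz, mul_inv_cancel_right₀ hfh0]⟩

end Summit.HodgeConjecture.HodgeConjecture.Cruxes.H413.F0P3cDyRamBoundaryCellLetterCardTwo

end
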